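import Summits.Ventures.HSemireg.WedgeHankelRecurrenceGaussZerosSeparation

/-!
# Venture HSemireg — **CONSISTENCY OF THE FAVARD MEASURES (the moment functional of a positive recurrence is well defined)**: if `(μ, z)` satisfies Favard's relations
# `Σ_k μ_k q_i(z_k) q_j(z_k) = δ_{ij} b_1⋯b_j` for `i, j ≤ m` on the zeros `z` of `q_{m+1}`, and `(ν, y)` satisfies them for `i, j ≤ n` with `n ≥ m + 1`, then the two functionals AGREE on every
# polynomial of degree `≤ 2m + 1`: `Σ_k μ_k F(z_k) = Σ_l ν_l F(y_l)` — so the finite Favard measures (N280 ∕ N281) form a projective system defining ONE moment functional `L` with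
# `L(q_i q_j) = δ_{ij} b_1⋯b_j`, and each `(μ^{(m)}, z^{(m)})` is its `(m+1)`-point Gauss rule

HONEST FRAMING. Part of the Lean index of the computation cell `pub-hsemireg` (seat p10 gen 42, Sunday typer «UNIFORM-IN-n»).  Real polynomials and finite sums only; no variety, no
cohomology theory, no sheaf, no Ext group and no semiregularity map is constructed here; nothing here says that HC / HC_CM / HC_AV holds; no Literature fact (unproved `Prop`) is declared or
used.  Custodian versions as in `WedgeHankelSiegelIdeal` (1/3).
SOURCES (cited).  J. Favard, *Sur les polynômes de Tchebicheff*, C. R. Acad. Sci. Paris 200 (1935) 2052–2053; T. S. Chihara, *An Introduction to Orthogonal Polynomials* (1978), Ch. I Thm 4.4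
(Favard: existence and uniqueness of the moment functional `L` with `L[1] = 1`, `L[P_m P_n] = 0`, `m ≠ n`) and Thm 6.2 (the Gauss quadrature of `L`); G. Szegő, *Orthogonal Polynomials*, §3.4.
PROOF TYPED HERE.  (1) For `deg R ≤ e ≤ m`, induction on `e`: `R = c q_e + R′`, and both functionals send `q_e = q_e q_0` to `δ_{e0}`.  (2) For `deg F ≤ 2m + 1`: `F = q_{m+1} G + R` with
`deg G, deg R ≤ m`; the `z`-side kills `q_{m+1} G` at the nodes, the `y`-side kills it by orthogonality of `q_{m+1}` to lower degrees (N285 `orthogonal_lower_of_pairwise`).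
DEDUP DISCLOSURE (`rg -n 'consistent|projective' Summits/Ventures/HSemireg/WedgeHankelRecurrenceGauss*`, 2026-09-02): nothing.  The 3 names below: 0 hits tree-wide.

WHAT IS IN THE TREE.  N279 `recurrence_monic_natDegree`, `eq_prod_X_sub_C_of_monic_of_roots`; N281 `favard_finite_explicit`; N285 `orthogonal_lower_of_pairwise`; N269
`natDegree_sub_C_mul_le_of_monic`; Mathlib `Polynomial.modByMonic_add_div`, `Polynomial.natDegree_modByMonic_lt`, `Polynomial.natDegree_divByMonic`.
THIS FILE (namespace `Summit.Ventures.HSemireg.Wedge.HankelOuter` continued; CHAINED on N285; 0 definitions):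
* §1051 `favard_levels_agree_low` (agreement on degree `≤ m` from the relations alone), **`favard_levels_agree`** (agreement on degree `≤ 2m + 1` when the level-`m` nodes are the zeros of
  `q_{m+1}`), **`favard_consistent`** (packaged with the explicit Favard weights of N281 at levels `m < n`).
CAVEATS.  Nothing Ext-side.  New names only.
-/

open Module Polynomial
open scoped Matrix Polynomial

namespace Summit.Ventures.HSemireg.Wedge.HankelOuter

/-! ## §1051. Consistency of the Favard functionals -/

/-- **Two Favard functionals agree on low degrees**: if `Σ_k μ_k q_i(z_k) q_j(z_k)` and `Σ_l ν_l q_i(y_l) q_j(y_l)` both equal `δ_{ij} h_j` for `i, j ≤ m` (`q_d` monic of degree `d`, `q_0 = 1`),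
then `Σ_k μ_k R(z_k) = Σ_l ν_l R(y_l)` for every `R` with `deg R ≤ m`. [Chihara I Thm 4.4 (uniqueness of `L`); this file, §1051] -/
theorem favard_levels_agree_low {M N m : ℕ} {μ z : Fin M → ℝ} {ν y : Fin N → ℝ} {q : ℕ → ℝ[X]} {h : ℕ → ℝ} (hq0 : q 0 = 1) (hmonic : ∀ d, d ≤ m → (q d).Monic)
    (hdeg : ∀ d, d ≤ m → (q d).natDegree = d)
    (hμ : ∀ i j, i ≤ m → j ≤ m → ∑ k, μ k * ((q i).eval (z k) * (q j).eval (z k)) = if i = j then h j else 0)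
    (hν : ∀ i j, i ≤ m → j ≤ m → ∑ l, ν l * ((q i).eval (y l) * (q j).eval (y l)) = if i = j then h j else 0) {R : ℝ[X]} (hR : R.natDegree ≤ m) :
    ∑ k, μ k * R.eval (z k) = ∑ l, ν l * R.eval (y l) := by
  -- the two functionals agree on each `q_d`, `d ≤ m`
  have hagree : ∀ d, d ≤ m → ∑ k, μ k * (q d).eval (z k) = ∑ l, ν l * (q d).eval (y l) := fun d hd => by
    have h1 := hμ d 0 hd (Nat.zero_le _)
    have h2 := hν d 0 hd (Nat.zero_le _)
    simp only [hq0, eval_one, mul_one] at h1 h2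
    rw [h1, h2]
  -- induction on a degree bound
  have key : ∀ e, e ≤ m → ∀ R : ℝ[X], R.natDegree ≤ e → ∑ k, μ k * R.eval (z k) = ∑ l, ν l * R.eval (y l) := by
    intro e
    induction e with
    | zero =>
      intro _ R hR0
      rw [eq_C_of_natDegree_le_zero hR0]
      simp only [eval_C]
      have h := hagree 0 (Nat.zero_le _)
      simp only [hq0, eval_one, mul_one] at h
      rw [← Finset.sum_mul, ← Finset.sum_mul, h]
    | succ e ih =>
      intro he R hR
      set c := R.coeff (e + 1) with hc
      set R' := R - C c * q (e + 1) with hR'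
      have hR'd : R'.natDegree ≤ e := by
        have := natDegree_sub_C_mul_le_of_monic hR (hmonic (e + 1) he) (hdeg (e + 1) he)
        simpa using this
      have h1 := ih (by omega) R' hR'd
      have h2 := hagree (e + 1) he
      have e1 : ∀ w : ℝ, R.eval w = R'.eval w + c * (q (e + 1)).eval w := fun w => by rw [hR']; simp only [eval_sub, eval_mul, eval_C]; ring
      simp only [e1, mul_add, Finset.sum_add_distrib]
      rw [h1, show ∑ k, μ k * (c * (q (e + 1)).eval (z k)) = c * ∑ k, μ k * (q (e + 1)).eval (z k) by rw [Finset.mul_sum]; exact Finset.sum_congr rfl fun k _ => by ring,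
        show ∑ l, ν l * (c * (q (e + 1)).eval (y l)) = c * ∑ l, ν l * (q (e + 1)).eval (y l) by rw [Finset.mul_sum]; exact Finset.sum_congr rfl fun l _ => by ring, h2]
  exact key m le_rfl R hR

/-- **AGREEMENT UP TO DEGREE `2m + 1`**: under the same relations for `(μ, z)` up to `m` and for `(ν, y)` up to `n ≥ m + 1`, if moreover the `z_k` are zeros of `q_{m+1}`, then
`Σ_k μ_k F(z_k) = Σ_l ν_l F(y_l)` for every `F` with `deg F ≤ 2m + 1` — the level-`m` Favard measure is the `(m+1)`-point Gauss rule of the level-`n` one. [Chihara I Thm 4.4 + Thm 6.2; this file, §1051] -/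
theorem favard_levels_agree {M N m n : ℕ} {μ z : Fin M → ℝ} {ν y : Fin N → ℝ} {q : ℕ → ℝ[X]} {h : ℕ → ℝ} (hq0 : q 0 = 1) (hmn : m + 1 ≤ n) (hmonic : ∀ d, d ≤ n → (q d).Monic)
    (hdeg : ∀ d, d ≤ n → (q d).natDegree = d)
    (hμ : ∀ i j, i ≤ m → j ≤ m → ∑ k, μ k * ((q i).eval (z k) * (q j).eval (z k)) = if i = j then h j else 0)
    (hν : ∀ i j, i ≤ n → j ≤ n → ∑ l, ν l * ((q i).eval (y l) * (q j).eval (y l)) = if i = j then h j else 0)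
    (hz : ∀ k, (q (m + 1)).eval (z k) = 0) {F : ℝ[X]} (hF : F.natDegree ≤ 2 * m + 1) :
    ∑ k, μ k * F.eval (z k) = ∑ l, ν l * F.eval (y l) := by
  set Q := q (m + 1) with hQ
  have hQm : Q.Monic := hmonic (m + 1) hmn
  have hQd : Q.natDegree = m + 1 := hdeg (m + 1) hmn
  have hQ1 : Q ≠ 1 := fun h1 => by rw [h1, natDegree_one] at hQd; omega
  have hdiv : F %ₘ Q + Q * (F /ₘ Q) = F := modByMonic_add_div F Q
  have hRd : (F %ₘ Q).natDegree ≤ m := by have := natDegree_modByMonic_lt F hQm hQ1; rw [hQd] at this; omega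
  have hGd : (F /ₘ Q).natDegree ≤ m := by rw [natDegree_divByMonic F hQm, hQd]; omega
  -- `z`-side: `Q` vanishes at the nodes
  have hzside : ∑ k, μ k * F.eval (z k) = ∑ k, μ k * (F %ₘ Q).eval (z k) := by
    refine Finset.sum_congr rfl fun k _ => ?_
    conv_lhs => rw [← hdiv]
    rw [eval_add, eval_mul, hz k, zero_mul, add_zero]
  -- `y`-side: `Q ⊥ (F /ₘ Q)` by orthogonality to lower degrees
  have hpair : ∀ i j, i ≤ n → j ≤ n → i ≠ j → ∑ l, ν l * ((q i).eval (y l) * (q j).eval (y l)) = 0 := fun i j hi hj hij => by rw [hν i j hi hj, if_neg hij]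
  have horth := orthogonal_lower_of_pairwise hmonic hdeg hpair hmn (G := F /ₘ Q) (by omega)
  have hyside : ∑ l, ν l * F.eval (y l) = ∑ l, ν l * (F %ₘ Q).eval (y l) := by
    have e : ∑ l, ν l * F.eval (y l) = ∑ l, ν l * (F %ₘ Q).eval (y l) + ∑ l, ν l * (Q * (F /ₘ Q)).eval (y l) := by
      rw [← Finset.sum_add_distrib]
      refine Finset.sum_congr rfl fun l _ => ?_
      conv_lhs => rw [← hdiv]
      rw [eval_add]; ring
    rw [e, horth, add_zero]
  rw [hzside, hyside]
  exact favard_levels_agree_low hq0 (fun d hd => hmonic d (by omega)) (fun d hd => hdeg d (by omega)) hμ (fun i j hi hj => hν i j (by omega) (by omega)) hRd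

/-- **CONSISTENCY OF THE EXPLICIT FAVARD MEASURES**: for a positive recurrence and `m < n`, the level-`m` and level-`n` Favard measures of N281 (zeros of `q_{m+1}`, `q_{n+1}` with the
weights `(b_1⋯b_·)/(q′ q)`) agree on every polynomial of degree `≤ 2m + 1`. [Favard 1935; Chihara I Thm 4.4, Thm 6.2; this file, §1051] -/
theorem favard_consistent {q : ℕ → ℝ[X]} {a b : ℕ → ℝ} (hq0 : q 0 = 1) (hq1 : q 1 = Polynomial.X - C (a 0))
    (hrec : ∀ n, q (n + 2) = (Polynomial.X - C (a (n + 1))) * q (n + 1) - C (b (n + 1)) * q n) (hb : ∀ j, 0 < b j) {m n : ℕ} (hmn : m < n) :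
    ∃ (z : Fin (m + 1) → ℝ) (y : Fin (n + 1) → ℝ), StrictMono z ∧ StrictMono y ∧ (∀ k, (q (m + 1)).eval (z k) = 0) ∧ (∀ l, (q (n + 1)).eval (y l) = 0) ∧
      ∀ F : ℝ[X], F.natDegree ≤ 2 * m + 1 →
        ∑ k, (∏ l ∈ Finset.Ico 1 (m + 1), b l) / ((derivative (q (m + 1))).eval (z k) * (q m).eval (z k)) * F.eval (z k)
          = ∑ l, (∏ l' ∈ Finset.Ico 1 (n + 1), b l') / ((derivative (q (n + 1))).eval (y l) * (q n).eval (y l)) * F.eval (y l) := by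
  obtain ⟨z, hz, hzr, -, -, hμ⟩ := favard_finite_explicit hq0 hq1 hrec hb m
  obtain ⟨y, hy, hyr, -, -, hν⟩ := favard_finite_explicit hq0 hq1 hrec hb n
  refine ⟨z, y, hz, hy, hzr, hyr, fun F hF => ?_⟩
  have hμ' : ∀ i j, i ≤ m → j ≤ m → ∑ k, (∏ l ∈ Finset.Ico 1 (m + 1), b l) / ((derivative (q (m + 1))).eval (z k) * (q m).eval (z k)) * ((q i).eval (z k) * (q j).eval (z k))
      = if i = j then ∏ l ∈ Finset.Ico 1 (j + 1), b l else 0 := fun i j hi hj => by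
    have h := hμ ⟨i, Nat.lt_succ_of_le hi⟩ ⟨j, Nat.lt_succ_of_le hj⟩
    simp only [Fin.mk.injEq] at h
    exact h
  have hν' : ∀ i j, i ≤ n → j ≤ n → ∑ l, (∏ l' ∈ Finset.Ico 1 (n + 1), b l') / ((derivative (q (n + 1))).eval (y l) * (q n).eval (y l)) * ((q i).eval (y l) * (q j).eval (y l))
      = if i = j then ∏ l ∈ Finset.Ico 1 (j + 1), b l else 0 := fun i j hi hj => by
    have h := hν ⟨i, Nat.lt_succ_of_le hi⟩ ⟨j, Nat.lt_succ_of_le hj⟩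
    simp only [Fin.mk.injEq] at h
    exact h
  exact favard_levels_agree (h := fun j => ∏ l ∈ Finset.Ico 1 (j + 1), b l) hq0 (Nat.succ_le_of_lt hmn) (fun d _ => (recurrence_monic_natDegree hq0 hq1 hrec d).1)
    (fun d _ => (recurrence_monic_natDegree hq0 hq1 hrec d).2) hμ' hν' hzr hF

end Summit.Ventures.HSemireg.Wedge.HankelOuter
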